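import Mathlib
import Literature.LinearAlgebra.Matrix.BipartiteForestRootCofactor
import Literature.NumberTheory.EllipticCurves.Smith2016.CongruentNumberGenusDeterminantEvenForest
import Literature.NumberTheory.EllipticCurves.Smith2016.CongruentNumberGenusDeterminantRowFiveA

/-!
# Smith 2016, Theorem 2.2 row 6 in forest form (every `k`): `det M₆ = Σ_j t_j adj(N₂)_{(inr j)(inr j)}`, evaluated

A. Smith, *The congruent numbers have positive natural density*, arXiv:1603.08479 [Smith2016CongruentDensity],
Table 2 row 6 (source `cnc.tex` l. 100–107): for `n ≡ 6 (mod 8)` with odd part `p₁⋯p_r`,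
`M₆ = [[A + Aᵀ + D_{y+z}, Aᵀ, y],[A, D_z, y],[yᵀ, yᵀ, 0]]` (`(2r+1) × (2r+1)`), i.e. Smith's
`M₂ = [[A + Aᵀ + D_{y+z}, Aᵀ],[A, D_z]]` (row 2) bordered by the column `(y; y)`, and Thm. 2.2 asserts
`det M₆ = ℒ₆(n) = Σ_{d₀d₁ | n, d₀ ≡ 7n (16), d₁ ≡ 7 (8)} g(d₀)g(d₁)ℒ(n/d₀d₁) + Σ_{d | n, d ≡ n (16)} g(d)ℒ(n/d)`;
§2.2 (source `cnc2.tex` l. 73–110) splits `det M₆` into the two single borders `(0; y)` and `(y; 0)`.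
Here Smith's `y` is `t = ((−1/pᵢ)₊)ᵢ`, `z = ((2/pᵢ)₊)ᵢ`, `A = legendreMatrix p` (Monsky's additive Legendre
matrix, zero row sums).

Over `𝔽₂`, `det [[M, b],[bᵀ, 0]] = bᵀ adj(M) b`; this file evaluates `bᵀ adj(M₂) b` for `b = (t; t)` as a
forest sum, for EVERY number of prime factors and with no hypothesis on `n mod 8`:
* `conj_fromBlocks_add_transpose_add` — the congruence `E = [[I, I],[0, I]]` takes `M₂` to the doubled
  forest matrix `N₂ = [[D_t, (A + D_z)ᵀ],[A + D_z, D_z]] = bigN a univ t z z` (marks `t`, roots `z`,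
  extra roots `z`), and `E (t; t) = (0; t)`: `border_adjugate_two_transport`;
* `border_adjugate_six_eq_sum_adjugate_inr` — hence **`(t;t)ᵀ adj(M₂) (t;t) = Σ_j t_j adj(N₂)_{(inr j),(inr j)}`**
  (a sum of ROOT-copy cofactors; Smith's two single borders recombined);
* `border_adjugate_six_eq_sum_powerset` — by the root-copy cofactor formula
  (`BipartiteForestRootCofactor`): `= Σ_{B ⊆ [k]} (Σ_B t) · q_t(A^B) · setExp(fwt a t z z)([k] ∖ B)`;
* `pointedWeight_neg_one_legendre_eq_genusWeight` — the dictionary for the new pointed block: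
  `(Σ_B t) · q_t(A^B) = [d_B ≡ 3 (4)] · g(d_B)` (for `d_B ≡ 3 (4)` the columns of `A^B` vanish, so
  `q_t = det(A^B | t) = (Σ_B t) · adj = g(d_B)` by Smith's Table 1 row `d ≡ 3 (4)`).
The identification of the complementary factor `setExp(fwt a t z z)` (Smith's `det M₂[S′]`) with genus sums
and the assembly into Tian–Yuan–Zhang's `Σ₂'` for `n ≡ 6 (8)` are in `CongruentNumberGenusDeterminantRowSix`.
-/

namespace Literature.NumberTheory.EllipticCurves.Smith2016

open _root_.Matrix Finset Literature.LinearAlgebra.Matrix Literature.Combinatorics.Enumerative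
open Literature.NumberTheory.EllipticCurves.HeathBrown1994
open Literature.NumberTheory.EllipticCurves.TianYuanZhang2017
open Literature.NumberTheory.EllipticCurves.HeathBrown1994.Families (legendreMatrix_apply_of_ne legendreMatrix_apply_self)
open Literature.NumberTheory.EllipticCurves.MonskySelmerParity

section Transport

variable {V : Type*} [Fintype V] [DecidableEq V]

/-- **The congruence for `M₂`.** `[[I, I],[0, I]] · [[A + Aᵀ + D′, Aᵀ],[A, D]] · [[I, 0],[I, I]] =
[[D + D′, Aᵀ + D],[A + D, D]]` over `𝔽₂` (any `A`, `D`, `D′`): Smith's `M₂ = M₁ + [[D_{y+z}, 0],[0, 0]]`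
goes to the doubled forest matrix with marks `D_z + D_{y+z} = D_y`.
[cite: Smith2016CongruentDensity, §2 Table 2 row 2 (the matrix M₂) and §2.2 (P(A, y, z))] -/
theorem conj_fromBlocks_add_transpose_add (A D D' : Matrix V V (ZMod 2)) :
    fromBlocks 1 1 0 1 * fromBlocks (A + Aᵀ + D') Aᵀ A D * fromBlocks 1 0 1 1 =
      fromBlocks (D + D') (Aᵀ + D) (A + D) D := by
  have hsplit : fromBlocks (A + Aᵀ + D') Aᵀ A D =
      fromBlocks (A + Aᵀ) Aᵀ A D + fromBlocks D' 0 0 0 := by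
    rw [fromBlocks_add, add_zero, add_zero, add_zero]
  rw [hsplit, Matrix.mul_add, Matrix.add_mul, conj_fromBlocks_add_transpose, fromBlocks_multiply,
    fromBlocks_multiply]
  simp only [Matrix.one_mul, Matrix.mul_one, Matrix.zero_mul, Matrix.mul_zero, add_zero]
  rw [fromBlocks_add, add_zero, add_zero, add_zero]

/-- **Transport of the border `(w; w)` along the congruence**: `(w;w)ᵀ adj(M₂) (w;w) =
(0;w)ᵀ adj(E M₂ Eᵀ) (0;w)` with `E = [[I, I],[0, I]]` (`E (w; w) = (0; w)` over `𝔽₂`, `adj(E) = E`).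
[cite: Smith2016CongruentDensity, §2.2 (source cnc2.tex l. 73–76: det M₆ split into the borders (0; y) and (y; 0))] [cite: HornJohnson2013, §0.8.2 (adj(AB) = adj(B) adj(A))] -/
theorem border_adjugate_two_transport (A D D' : Matrix V V (ZMod 2)) (w : V → ZMod 2) :
    Sum.elim w w ⬝ᵥ ((fromBlocks (A + Aᵀ + D') Aᵀ A D).adjugate *ᵥ Sum.elim w w) =
      Sum.elim (0 : V → ZMod 2) w ⬝ᵥ
        ((fromBlocks (D + D') (Aᵀ + D) (A + D) D).adjugate *ᵥ Sum.elim (0 : V → ZMod 2) w) := by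
  have hEt : (fromBlocks (1 : Matrix V V (ZMod 2)) (1 : Matrix V V (ZMod 2)) (0 : Matrix V V (ZMod 2)) (1 : Matrix V V (ZMod 2)))ᵀ =
      fromBlocks (1 : Matrix V V (ZMod 2)) (0 : Matrix V V (ZMod 2)) (1 : Matrix V V (ZMod 2)) (1 : Matrix V V (ZMod 2)) := by
    rw [fromBlocks_transpose, transpose_one, transpose_zero]
  have hconj := conj_fromBlocks_add_transpose_add A D D'
  rw [← hEt] at hconj
  have hEu : fromBlocks (1 : Matrix V V (ZMod 2)) (1 : Matrix V V (ZMod 2)) (0 : Matrix V V (ZMod 2)) (1 : Matrix V V (ZMod 2)) *ᵥ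
      Sum.elim (0 : V → ZMod 2) w = Sum.elim w w := by
    rw [fromBlocks_mulVec]
    ext (i | i) <;> simp
  rw [← hconj, adjugate_mul_distrib, adjugate_mul_distrib, ← adjugate_transpose,
    adjugate_fromBlocks_one_one_zero_one, ← mulVec_mulVec, ← mulVec_mulVec, hEu]
  conv_rhs => rw [dotProduct_mulVec, vecMul_transpose, hEu]

/-- The bordered form of a symmetric matrix over `𝔽₂` with a border supported on the second block only
sees the diagonal cofactors there: `(0; w)ᵀ adj(N) (0; w) = Σ_j w_j adj(N)_{(inr j),(inr j)}`.
[cite: HornJohnson2013, §4.1 (quadratic form of a symmetric matrix), characteristic 2] -/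
theorem border_adjugate_eq_sum_inr {N : Matrix (V ⊕ V) (V ⊕ V) (ZMod 2)} (hN : Nᵀ = N) (w : V → ZMod 2) :
    Sum.elim (0 : V → ZMod 2) w ⬝ᵥ (N.adjugate *ᵥ Sum.elim (0 : V → ZMod 2) w) =
      ∑ j, w j * N.adjugate (Sum.inr j) (Sum.inr j) := by
  have hadj : (N.adjugate)ᵀ = N.adjugate := by rw [adjugate_transpose, hN]
  rw [dotProduct_mulVec_eq_sum_diag hadj, Fintype.sum_sum_type]
  simp only [Sum.elim_inl, Sum.elim_inr, Pi.zero_apply, mul_zero, sum_const_zero, zero_add]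
  exact sum_congr rfl fun j _ => mul_comm _ _

end Transport

variable {k : ℕ} (p : Fin k → ℕ)

section RowSixForest

/-- **`det M₆` as a sum of root-copy cofactors** (every `k`, no hypothesis): with `t = ((−1/pᵢ)₊)`,
`z = ((2/pᵢ)₊)`, `M₂ = [[A + Aᵀ + D_t + D_z, Aᵀ],[A, D_z]]` and `N₂ = bigN a univ t z z`,
`(t;t)ᵀ adj(M₂) (t;t) = Σ_j t_j · adj(N₂)_{(inr j),(inr j)}`.
[cite: Smith2016CongruentDensity, Thm. 2.2 row 6 / Table 2 (source cnc.tex l. 100–107) and §2.2 (cnc2.tex l. 73–110)] -/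
theorem border_adjugate_six_eq_sum_adjugate_inr :
    Sum.elim (fun i => addLegendreSym (-1) (p i)) (fun i => addLegendreSym (-1) (p i)) ⬝ᵥ
        ((fromBlocks (legendreMatrix p + (legendreMatrix p)ᵀ + (legendreDiagonal p (-1) + legendreDiagonal p 2))
            (legendreMatrix p)ᵀ (legendreMatrix p) (legendreDiagonal p 2)).adjugate *ᵥ
          Sum.elim (fun i => addLegendreSym (-1) (p i)) (fun i => addLegendreSym (-1) (p i))) =
      ∑ j, addLegendreSym (-1) (p j) *
        (bigN (fun i j => legendreMatrix p i j) univ (fun i => addLegendreSym (-1) (p i))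
          (fun i => addLegendreSym 2 (p i)) (fun i => addLegendreSym 2 (p i))).adjugate
            (Sum.inr j) (Sum.inr j) := by
  have hD2 : legendreDiagonal p 2 = diagonal fun i => addLegendreSym 2 (p i) := rfl
  have hD1 : legendreDiagonal p (-1) = diagonal fun i => addLegendreSym (-1) (p i) := rfl
  have hdd : (diagonal fun i => addLegendreSym 2 (p i)) + ((diagonal fun i => addLegendreSym (-1) (p i)) +
      diagonal fun i => addLegendreSym 2 (p i)) = diagonal fun i => addLegendreSym (-1) (p i) := by
    rw [← add_assoc, add_comm (diagonal fun i => addLegendreSym 2 (p i)), add_assoc, matrix_add_self,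
      add_zero]
  have hNeq : fromBlocks (legendreDiagonal p 2 + (legendreDiagonal p (-1) + legendreDiagonal p 2))
      ((legendreMatrix p)ᵀ + legendreDiagonal p 2) (legendreMatrix p + legendreDiagonal p 2)
      (legendreDiagonal p 2) =
      bigN (fun i j => legendreMatrix p i j) univ (fun i => addLegendreSym (-1) (p i))
        (fun i => addLegendreSym 2 (p i)) (fun i => addLegendreSym 2 (p i)) := by
    rw [bigN_univ_eq_fromBlocks_mark _ (legendreMatrix_apply_self p), hD2, hD1, hdd, transpose_add,
      diagonal_transpose]
  rw [border_adjugate_two_transport, hNeq, border_adjugate_eq_sum_inr (bigN_transpose _ _ _ _ _)]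

/-- **`det M₆` as a rooted pointed forest sum** (every `k`, no hypothesis):
`(t;t)ᵀ adj(M₂) (t;t) = Σ_{B ⊆ [k]} (Σ_{i∈B} tᵢ) · q_t(A^B) · Σ_{π ∈ Part([k]∖B)} ∏_{C∈π} (t_C q_z(A^C) + q_z(A^C))`
— one block re-rooted by `t`, the others Smith's `det M₂[S′]` in forest form.
[cite: Smith2016CongruentDensity, Thm. 2.2 row 6 and §2.2 (cnc2.tex l. 77–84, l. 100–110)] [cite: Chaiken1982, §2 (all minors matrix tree theorem)] -/
theorem border_adjugate_six_eq_sum_powerset :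
    Sum.elim (fun i => addLegendreSym (-1) (p i)) (fun i => addLegendreSym (-1) (p i)) ⬝ᵥ
        ((fromBlocks (legendreMatrix p + (legendreMatrix p)ᵀ + (legendreDiagonal p (-1) + legendreDiagonal p 2))
            (legendreMatrix p)ᵀ (legendreMatrix p) (legendreDiagonal p 2)).adjugate *ᵥ
          Sum.elim (fun i => addLegendreSym (-1) (p i)) (fun i => addLegendreSym (-1) (p i))) =
      ∑ B ∈ (univ : Finset (Fin k)).powerset, (∑ i ∈ B, addLegendreSym (-1) (p i)) *
        qwt (fun i j => legendreMatrix p i j) (fun i => addLegendreSym (-1) (p i)) B *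
          setExp (fwt (fun i j => legendreMatrix p i j) (fun i => addLegendreSym (-1) (p i))
            (fun i => addLegendreSym 2 (p i)) (fun i => addLegendreSym 2 (p i))) (univ \ B) := by
  rw [border_adjugate_six_eq_sum_adjugate_inr,
    show (∑ j, addLegendreSym (-1) (p j) *
        (bigN (fun i j => legendreMatrix p i j) univ (fun i => addLegendreSym (-1) (p i))
          (fun i => addLegendreSym 2 (p i)) (fun i => addLegendreSym 2 (p i))).adjugate (Sum.inr j) (Sum.inr j)) =
      ∑ j ∈ (univ : Finset (Fin k)), addLegendreSym (-1) (p j) *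
        (bigN (fun i j => legendreMatrix p i j) univ (fun i => addLegendreSym (-1) (p i))
          (fun i => addLegendreSym 2 (p i)) (fun i => addLegendreSym 2 (p i))).adjugate (Sum.inr j) (Sum.inr j)
      from rfl,
    sum_mul_adjugate_bigN_inr]

end RowSixForest

section Dictionary

/-- **The dictionary for the re-rooted block** (Smith's Table 1, row `d ≡ 3 (4)`): for every nonempty block
`B` of a tuple of distinct odd primes, `(Σ_{i∈B} tᵢ) · q_t(A^B) = [d_B ≡ 3 (4)] · g(d_B)` in `𝔽₂`
(`t = ((−1/pᵢ)₊)`, `d_B = ∏_B pᵢ`, `g(d) = #2Cl(ℚ(√−d))`).  For `d_B ≡ 3 (4)` the columns of `A^B` sum to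
zero, so `q_t(A^B) = det(A^B with a column replaced by t) = (Σ_B t) · adj(A^B)_{cc} = g(d_B)`; for
`d_B ≡ 1 (4)` the prefactor `Σ_B t` vanishes.
[cite: Smith2016CongruentDensity, §2 Table 1 row n ≡ 3 (4) and §2.2 (cnc2.tex l. 100–107: "this determinant is nonzero iff det(A + D_z) ≠ 0"; the O(A, y, y) blocks of l. 66–70)] [cite: LiMa2008, Thm. 0.4 (Rédei–Reichardt)] -/
theorem pointedWeight_neg_one_legendre_eq_genusWeight (hp : ∀ i, (p i).Prime) (hodd : ∀ i, Odd (p i))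
    (hinj : Function.Injective p) {B : Finset (Fin k)} (hB : B.Nonempty) :
    (∑ i ∈ B, addLegendreSym (-1) (p i)) *
        qwt (fun i j => legendreMatrix p i j) (fun i => addLegendreSym (-1) (p i)) B =
      if (∏ i ∈ B, p i) % 4 = 1 then 0
      else ((genusClassNumber (GenusField (∏ i ∈ B, p i)) : ℕ) : ZMod 2) := by
  obtain ⟨c, hc⟩ := hB
  set q : Fin B.card → ℕ := fun x => p ((B.equivFin.symm x : {i // i ∈ B}) : Fin k) with hq
  have hqp : ∀ x, (q x).Prime := fun x => hp _
  have hqo : ∀ x, Odd (q x) := fun x => hodd _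
  have hq2 : ∀ x, q x ≠ 2 := ne_two_of_odd q hqo
  have hqinj : Function.Injective q := fun x y h =>
    B.equivFin.symm.injective (Subtype.ext (hinj h))
  have hprod : ∏ x, q x = ∏ i ∈ B, p i := prod_subtuple p B
  have ht : ∑ i ∈ B, addLegendreSym (-1) (p i) = if (∏ i ∈ B, p i) % 4 = 1 then 0 else 1 := by
    rw [← sum_subtuple p B (fun n => addLegendreSym (-1) n), sum_addLegendreSym_neg_one_eq q hqp hq2, hprod]
  by_cases h1 : (∏ i ∈ B, p i) % 4 = 1
  · rw [ht, if_pos h1, if_pos h1, zero_mul]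
  · rw [ht, if_neg h1, if_neg h1, one_mul]
    have hdodd : Odd (∏ i ∈ B, p i) := hprod ▸ MonskySelmerParity.odd_prod q hqp hq2
    have hd2 : (∏ i ∈ B, p i) % 2 = 1 := Nat.odd_iff.mp hdodd
    have h3 : (∏ i ∈ B, p i) % 4 = 3 := by omega
    have h3q : (∏ x, q x) % 4 = 3 := by rw [hprod]; exact h3
    -- the column form of the block weight, re-indexed to the sub-tuple
    have hqwt : qwt (fun i j => legendreMatrix p i j) (fun i => addLegendreSym (-1) (p i)) B =
        ((legendreMatrix q).updateCol (B.equivFin ⟨c, hc⟩) fun x => addLegendreSym (-1) (q x)).det := by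
      rw [qwt_eq_det_updateCol _ _ hc, det_updateCol_lap_eq_subtuple p B hc _ (fun i hi => if_neg hi)]
      congr 2
      funext x
      rw [if_pos (B.equivFin.symm x).2]
    haveI : Nonempty (Fin B.card) := ⟨B.equivFin ⟨c, hc⟩⟩
    rw [hqwt, det_updateCol_eq_sum_mul_adjugate (legendreMatrix q)
      (one_vecMul_legendreMatrix_of_three_mod_four q hqp hqo hqinj h3q) _ _,
      sum_addLegendreSym_neg_one_eq q hqp hq2, if_neg (by rw [hprod]; exact h1), one_mul]
    have hadj := odd_genusClassNumber_genusField_iff_adjugate q hqp hqo hqinj h3q (B.equivFin ⟨c, hc⟩)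
    rw [hprod] at hadj
    symm
    exact natCast_eq_of_odd_iff hadj

end Dictionary

end Literature.NumberTheory.EllipticCurves.Smith2016
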